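import Literature.NumberTheory.LFunctions.LagariasDifferencedXiInterlaceProofs
import Literature.Analysis.DeBrangesSpaces.DeBranges1986CharacterSpacesProofs
import Mathlib.Analysis.Complex.PhragmenLindelof
import HarnessLib

/-!
# Lagarias 2005, §5: Lemma 5.1 (1) and Theorem 5.1 (1) for differenced Dirichlet `L`-functions (PROVED)

LABEL (line 1): **RH-FREE** — discharge of the two unconditional §5 named facts typed in
`LagariasDifferencedXiSpacings.lean` (cell rh-crit/dbl, corpus C2, source S5):

* `Literature.NumberTheory.LFunctions.lagarias2005_lemma_5_1_1` — **Lemma 5.1 (1)**: for a primitive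
  non-principal Dirichlet character `χ` (conductor `N`) and `h ≥ ½`, `E_h(s, χ) := ξ(s + h, χ)` satisfies
  `|E_h(s, χ)| > |E_h(1 − s̄, χ)|` for `Re(s) > ½` ((5.3));
* `Literature.NumberTheory.LFunctions.lagarias2005_thm_5_1_1` — **Theorem 5.1 (1)**: for `|h| ≥ ½` and
  `0 ≤ θ < 2π` the entire functions `A_{h,θ}(s, χ)`, `B_{h,θ}(s, χ)` of
  `E_{h,θ}(s, χ) = e^{iθ} ξ(s + h, χ) = A_{h,θ}(s, χ) − i B_{h,θ}(s, χ)` have all their zeros on the critical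
  line `Re(s) = ½`, all simple, and interlacing.

Source: J. C. Lagarias, *Zero spacing distributions for differenced L-functions*, Acta Arith. 120 (2005)
159–184 = arXiv:math/0601653 [Lagarias2005], §5 (held text `paper:arxiv-math_0601653` p0010: Lemma 5.1
L28–36 with its proof L38–72, Theorem 5.1 L85–104). bears_on: LADDER-RH B-C/B-P (COLUMN 6, de Branges).
WHAT THIS IS NOT: transcription-grade discharge of printed, unconditional statements about `ξ(s, χ)`;
no positivity condition and no RH-direction is asserted; nothing here bears on the truth of RH.

## The printed proofs and the one deviation

* **Lemma 5.1 (1).** Lagarias: "The proofs are similar to those for Lemma 2.1. We need to know that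
  `ξ(s, χ)` has a modified Hadamard product (5.4) … `Re(B*(χ)) ≥ 0`, and the rest of the proof follows
  that of Lemma 2.1" (zero-by-zero comparison in the genus-one Hadamard product). The tree has the Hadamard
  product for `ξ` (used for the `ζ` case, `lagarias2005_lemma_2_1_holds`) but NOT for `ξ(s, χ)`
  (GAP-LEDGER G-dbl-15). DEVIATION (the same road as the tree's de Branges 1986 discharge
  `Literature.Analysis.DeBrangesSpaces.DeBranges1986.norm_dirichletXi_lt_norm_dirichletXi_add_one`, which is
  exactly the case `h = ½`): by `ξ(1 − s̄, χ) = ε(χ) conj ξ(s, χ)`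
  (`DirichletTheta.dirichletXi_one_sub_conj`, `|ε(χ)| = 1`) one has `|E_h(1 − s̄, χ)| = |ξ(s − h, χ)|`, so
  (5.3) reads `|ξ(s − h, χ)| < |ξ(s + h, χ)|`, `Re s > ½`; with `s = ½ + z` this is `|g(z)| < 1` for
  `g(z) = ξ(½ − h + z, χ)/ξ(½ + h + z, χ)` on `Re z > 0`. For `h ≥ ½` the denominator has real part
  `≥ 1`, hence no zeros (`DirichletTheta.dirichletXi_ne_zero_of_not_mem_strip`); `|g| = 1` on `Re z = 0`
  (the reflection formula again); `g(x) → 0` along the positive reals (`|L| ≤ 2`, `|L| ≥ ½` to the right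
  of `2`, the `(q/π)`-powers contribute the constant `(q/π)^{−h}`, and
  `Γ(u)/Γ(u + h) ≤ Γ(u)/Γ(u + ½) ≤ (u − ½)^{−1/2}` by monotonicity of `Γ` on `[2, ∞)` and log-convexity);
  `|g(z)| ≤ exp(B|z|^{3/2})` on the half-plane (Stirling `|log|Γ(w)|| ≤ 13|w|^{3/2}`
  (`DeBranges1986.abs_log_norm_Gamma_le`), MV Lemma 10.15 `|L(s, χ)| ≤ q|s|Z`
  (`DirichletZFR.norm_LFunction_le_of_re_ge`), `|L| ≥ (σ−1)/σ` (`DirichletZFR.norm_LFunction_ge`) and MV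
  Theorem 11.4 `1/|L| ≪ log q(|t| + 4)` on `σ ≥ 1`, `|t| ≥ 1` (`DeBranges1986.exists_norm_inv_LFunction_le`)).
  Phragmén–Lindelöf on the right half-plane (Mathlib `PhragmenLindelof.right_half_plane_of_tendsto_zero_on_real`)
  gives `|g| ≤ 1`, and the maximum modulus principle makes it strict (`g` is not a unimodular constant as
  `g(x) → 0`).
* **Theorem 5.1 (1).** Lagarias: "established by essentially the same proof as Theorem 2.1, using Lemma
  5.1 in place of Lemma 2.1". Followed literally with the tree's general-`E` form of that proof: Lemma 5.1
  (1) says `E_{h,θ}(·, χ)` satisfies hypothesis (2.6) of Lemma 2.2 for `h ≥ ½` (`diffXiCharErot_critHB`),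
  so all zeros of `A`, `B` are on the line (`lagarias2005_lemma_2_2_zeros`), they interlace
  (`lagarias2005_lemma_2_2_interlace_holds`, de Branges' lemma), and they are simple because
  `E_{h,θ}(½ + it, χ) = e^{iθ} ξ(½ + h + it, χ) ≠ 0` (`Re ≥ 1`) forces `Re E′/E > 0` there
  (`deriv_critRePart_ne_zero_of_ne` / `deriv_critImPart_ne_zero_of_ne`). For `h ≤ −½` ("the statements
  are invariant under `h ↦ −h`"): `E_{−h,θ}(·, χ) = (E_{h,θ′}(·, χ))♯` with `e^{iθ′} = e^{−iθ} conj ε(χ)`,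
  whence `A_{−h,θ} = A_{h,θ′}`, `B_{−h,θ} = −B_{h,θ′}` (`diffXiCharArot_neg`, `diffXiCharBrot_neg`) — the
  `χ`-analogue of the `ζ`-case `diffXiArot_neg` (where `ε = 1`, `θ′ = −θ`).

## Main results

* `Literature.NumberTheory.LFunctions.lagarias2005_lemma_5_1_1_holds`,
  `Literature.NumberTheory.LFunctions.lagarias2005_thm_5_1_1_holds` — the two discharges.
* `Literature.NumberTheory.LFunctions.Lagarias2005Char.norm_dirichletXi_sub_lt_norm_dirichletXi_add` —
  `|ξ(s − h, χ)| < |ξ(s + h, χ)|` for `Re s > ½`, `h ≥ ½` (any primitive `χ ≠ 1`).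
* Reusable size bounds for `ξ(s, χ)`: `Lagarias2005Char.exists_norm_dirichletXi_le_exp` (`‖s‖ ≥ 3`, all
  `s`), `Lagarias2005Char.exists_norm_dirichletXi_le_exp_of_re` (`Re s ≥ ½`, `‖s‖ ≥ 2`),
  `Lagarias2005Char.exists_exp_neg_le_norm_dirichletXi` (`Re s ≥ 1`, `‖s‖ ≥ 3`),
  `Lagarias2005Char.norm_dirichletXi_ofReal`.
* `diffXiCharErot_critHB`, `diffXiChar_zeroPattern`, `diffXiCharArot_neg`, `diffXiCharBrot_neg`.

## References

* [Lagarias2005] J. C. Lagarias, Acta Arith. 120 (2005) 159–184 = arXiv:math/0601653, §5: Lemma 5.1,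
  Theorem 5.1 (arXiv p. 10), with Lemma 2.1/2.2 and Theorem 2.1 (§2).
* [deBranges1986] L. de Branges, Bull. AMS 15 (1986) 1–17, p. 12 (the `h = ½` case, tree
  `DeBranges1986CharacterSpacesProofs.lean`).
* [MontgomeryVaughan2007] H. L. Montgomery, R. C. Vaughan, *Multiplicative Number Theory I*, CUP 2007,
  (10.19), Cor. 10.8, Lemma 10.15, Theorem 11.4.
-/

noncomputable section

open scoped ComplexConjugate Real Topology
open Complex Filter Set Asymptotics

namespace Literature.NumberTheory.LFunctions

open DirichletTheta
open Literature.Analysis.DeBrangesSpaces.DeBranges1986 (norm_dirichletXi_eq abs_log_norm_Gamma_le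
  exists_norm_inv_LFunction_le norm_dirichletXi_one_sub_conj)
open DirichletZFR (norm_LFunction_le_of_re_ge norm_LFunction_ge one_le_tsum_rpow)
open ZetaClassicalRegion (norm_LSeries_le_of_norm_le_one)

namespace Lagarias2005Char

variable {q : ℕ} [NeZero q] {χ : DirichletCharacter ℂ q}

/-! ## Elementary facts -/

/-- `‖Γ(w)‖ ≤ exp(13 ‖w‖^{3/2})` for `Re w > 0`, `‖w‖ ≥ 1` (from the tree's crude Stirling bound
`DeBranges1986.abs_log_norm_Gamma_le`). [folklore] -/
private theorem norm_Gamma_le_exp {w : ℂ} (hw : 0 < w.re) (hw1 : 1 ≤ ‖w‖) :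
    ‖Complex.Gamma w‖ ≤ Real.exp (13 * ‖w‖ ^ (3 / 2 : ℝ)) := by
  have hpos : 0 < ‖Complex.Gamma w‖ := norm_pos_iff.2 (Complex.Gamma_ne_zero_of_re_pos hw)
  have h := (abs_le.1 (abs_log_norm_Gamma_le hw hw1)).2
  calc ‖Complex.Gamma w‖ = Real.exp (Real.log ‖Complex.Gamma w‖) := (Real.exp_log hpos).symm
    _ ≤ Real.exp (13 * ‖w‖ ^ (3 / 2 : ℝ)) := Real.exp_le_exp.2 h

/-- `exp(−13 ‖w‖^{3/2}) ≤ ‖Γ(w)‖` for `Re w > 0`, `‖w‖ ≥ 1` (from the tree's crude Stirling bound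
`DeBranges1986.abs_log_norm_Gamma_le`). [folklore] -/
private theorem exp_neg_le_norm_Gamma {w : ℂ} (hw : 0 < w.re) (hw1 : 1 ≤ ‖w‖) :
    Real.exp (-(13 * ‖w‖ ^ (3 / 2 : ℝ))) ≤ ‖Complex.Gamma w‖ := by
  have hpos : 0 < ‖Complex.Gamma w‖ := norm_pos_iff.2 (Complex.Gamma_ne_zero_of_re_pos hw)
  have h := (abs_le.1 (abs_log_norm_Gamma_le hw hw1)).1
  calc Real.exp (-(13 * ‖w‖ ^ (3 / 2 : ℝ))) ≤ Real.exp (Real.log ‖Complex.Gamma w‖) :=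
        Real.exp_le_exp.2 h
    _ = ‖Complex.Gamma w‖ := Real.exp_log hpos

/-- **`Γ(u) ≤ (u − ½)^{−1/2} Γ(u + h)`** for real `u ≥ 2`, `h ≥ ½`: `Γ(u + ½) ≤ Γ(u + h)` (`Γ` increases on
`[2, ∞)`) and `Γ(u)² ≤ Γ(u − ½) Γ(u + ½) = Γ(u + ½)²/(u − ½)` (log-convexity of `Γ`). [folklore] -/
private theorem real_Gamma_le_rpow_mul_Gamma_add {u h : ℝ} (hu : 2 ≤ u) (hh : 1 / 2 ≤ h) :
    Real.Gamma u ≤ (u - 1 / 2) ^ (-(1 / 2 : ℝ)) * Real.Gamma (u + h) := by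
  have hu0 : 0 < u - 1 / 2 := by linarith
  have hG1 : 0 < Real.Gamma (u + 1 / 2) := Real.Gamma_pos_of_pos (by linarith)
  -- monotonicity of `Γ` on `[2, ∞)`
  have hmono : Real.Gamma (u + 1 / 2) ≤ Real.Gamma (u + h) :=
    Real.Gamma_strictMonoOn_Ici.monotoneOn (show (2 : ℝ) ≤ u + 1 / 2 by linarith)
      (show (2 : ℝ) ≤ u + h by linarith) (by linarith)
  -- log-convexity: `Γ(u) ≤ Γ(u − ½)^{1/2} Γ(u + ½)^{1/2}`
  have hconv := Real.Gamma_mul_add_mul_le_rpow_Gamma_mul_rpow_Gamma (s := u - 1 / 2) (t := u + 1 / 2)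
    (a := 1 / 2) (b := 1 / 2) hu0 (by linarith) (by norm_num) (by norm_num) (by norm_num)
  have hmid : (1 / 2 : ℝ) * (u - 1 / 2) + 1 / 2 * (u + 1 / 2) = u := by ring
  rw [hmid] at hconv
  -- the functional equation `Γ(u + ½) = (u − ½) Γ(u − ½)`
  have hrec : Real.Gamma (u + 1 / 2) = (u - 1 / 2) * Real.Gamma (u - 1 / 2) := by
    have e := Real.Gamma_add_one hu0.ne'
    rw [show u - 1 / 2 + 1 = u + 1 / 2 by ring] at e
    exact e
  have hhalf : Real.Gamma (u - 1 / 2) ^ (1 / 2 : ℝ) * Real.Gamma (u + 1 / 2) ^ (1 / 2 : ℝ) =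
      (u - 1 / 2) ^ (-(1 / 2 : ℝ)) * Real.Gamma (u + 1 / 2) := by
    have e1 : Real.Gamma (u - 1 / 2) = Real.Gamma (u + 1 / 2) * (u - 1 / 2)⁻¹ := by
      rw [hrec, mul_comm (u - 1 / 2), mul_assoc, mul_inv_cancel₀ hu0.ne', mul_one]
    have e2 : Real.Gamma (u + 1 / 2) ^ (1 / 2 : ℝ) * Real.Gamma (u + 1 / 2) ^ (1 / 2 : ℝ) =
        Real.Gamma (u + 1 / 2) := by
      rw [← Real.rpow_add hG1]; norm_num
    rw [e1, Real.mul_rpow hG1.le (inv_nonneg.2 hu0.le), Real.inv_rpow hu0.le, ← Real.rpow_neg hu0.le]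
    calc Real.Gamma (u + 1 / 2) ^ (1 / 2 : ℝ) * (u - 1 / 2) ^ (-(1 / 2 : ℝ)) *
          Real.Gamma (u + 1 / 2) ^ (1 / 2 : ℝ)
        = (u - 1 / 2) ^ (-(1 / 2 : ℝ)) *
            (Real.Gamma (u + 1 / 2) ^ (1 / 2 : ℝ) * Real.Gamma (u + 1 / 2) ^ (1 / 2 : ℝ)) := by ring
      _ = (u - 1 / 2) ^ (-(1 / 2 : ℝ)) * Real.Gamma (u + 1 / 2) := by rw [e2]
  rw [hhalf] at hconv
  exact hconv.trans (mul_le_mul_of_nonneg_left hmono (Real.rpow_nonneg hu0.le _))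

/-! ## The size of `ξ(s, χ)` -/

omit [NeZero q] in
/-- `‖(s + κ)/2‖ ≥ ‖s‖/2` and `≤ ‖s‖` when `Re s ≥ 0`, `‖s‖ ≥ 1` (`κ ∈ {0, 1}` the parity). [folklore] -/
private theorem norm_half_add_parity_bounds {s : ℂ} (hs : 0 ≤ s.re) (h1 : 1 ≤ ‖s‖) :
    ‖s‖ / 2 ≤ ‖(s + charParity χ) / 2‖ ∧ ‖(s + charParity χ) / 2‖ ≤ ‖s‖ := by
  have hκ : (charParity χ : ℝ) ≤ 1 := by exact_mod_cast charParity_le_one χ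
  have hκ0 : (0 : ℝ) ≤ charParity χ := (charParity χ).cast_nonneg
  constructor
  · rw [norm_div, Complex.norm_ofNat]
    gcongr
    rw [← Real.sqrt_sq (norm_nonneg s), ← Real.sqrt_sq (norm_nonneg (s + _)),
      Complex.sq_norm, Complex.sq_norm, Complex.normSq_apply, Complex.normSq_apply]
    apply Real.sqrt_le_sqrt
    simp only [Complex.add_re, Complex.natCast_re, Complex.add_im, Complex.natCast_im, add_zero]
    nlinarith
  · rw [norm_div, Complex.norm_ofNat]
    have : ‖s + (charParity χ : ℂ)‖ ≤ ‖s‖ + 1 := by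
      refine (norm_add_le _ _).trans ?_
      rw [Complex.norm_natCast]
      linarith
    linarith

/-- **Upper bound** `|ξ(s, χ)| ≤ exp(K‖s‖^{3/2})` for `Re s ≥ ½`, `‖s‖ ≥ 2` (`K` depending on `q` only):
MV Lemma 10.15 `|L(s, χ)| ≤ q‖s‖Z`, Stirling for `Γ`, and `(q/π)^{Re} ≤ e^{q‖s‖}`.
[cite: MontgomeryVaughan2007, Lemma 10.15 with (10.19)] -/
theorem exists_norm_dirichletXi_le_exp_of_re (h1 : χ ≠ 1) :
    ∃ K : ℝ, 0 ≤ K ∧ ∀ s : ℂ, 1 / 2 ≤ s.re → 2 ≤ ‖s‖ →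
      ‖dirichletXi χ s‖ ≤ Real.exp (K * ‖s‖ ^ (3 / 2 : ℝ)) := by
  set Z : ℝ := ∑' n : ℕ, ((n + 1 : ℕ) : ℝ) ^ (-(5 / 4 : ℝ)) with hZ
  have hZ1 : 1 ≤ Z := one_le_tsum_rpow
  refine ⟨q * Z + 13 + q, by positivity, fun s hs h2 ↦ ?_⟩
  have hs0 : 0 < s.re := by linarith
  have hx1 : 1 ≤ ‖s‖ := by linarith
  have hx0 : 0 < ‖s‖ := by linarith
  set x : ℝ := ‖s‖ with hx
  have h32 : x ≤ x ^ (3 / 2 : ℝ) := by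
    have := Real.rpow_le_rpow_of_exponent_le hx1 (show (1 : ℝ) ≤ 3 / 2 by norm_num)
    rwa [Real.rpow_one] at this
  have hx32 : 0 ≤ x ^ (3 / 2 : ℝ) := by positivity
  obtain ⟨hwlo, hwhi⟩ := norm_half_add_parity_bounds (χ := χ) hs0.le hx1
  set w : ℂ := (s + charParity χ) / 2 with hw
  have hwre : 0 < w.re := by
    rw [hw]
    simp only [Complex.div_ofNat_re, Complex.add_re, Complex.natCast_re]
    linarith [(charParity χ).cast_nonneg (α := ℝ)]
  have hw1 : 1 ≤ ‖w‖ := by linarith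
  have hL : ‖χ.LFunction s‖ ≤ Real.exp (q * Z * x ^ (3 / 2 : ℝ)) := by
    refine (norm_LFunction_le_of_re_ge χ h1 (by linarith)).trans ?_
    calc (q : ℝ) * ‖s‖ * Z = q * Z * x := by rw [hx]; ring
      _ ≤ q * Z * x ^ (3 / 2 : ℝ) := by gcongr
      _ ≤ Real.exp (q * Z * x ^ (3 / 2 : ℝ)) := by
          linarith [Real.add_one_le_exp (q * Z * x ^ (3 / 2 : ℝ))]
  have hG : ‖Complex.Gamma w‖ ≤ Real.exp (13 * x ^ (3 / 2 : ℝ)) := by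
    refine (norm_Gamma_le_exp hwre hw1).trans (Real.exp_le_exp.2 ?_)
    gcongr
  have hP : ((q : ℝ) / π) ^ ((s.re + charParity χ) / 2) ≤ Real.exp (q * x ^ (3 / 2 : ℝ)) := by
    have ha0 : 0 ≤ (s.re + charParity χ) / 2 := by
      linarith [(charParity χ).cast_nonneg (α := ℝ)]
    have ha1 : (s.re + charParity χ) / 2 ≤ x := by
      have hre : s.re ≤ ‖s‖ := Complex.re_le_norm s
      have hκ : (charParity χ : ℝ) ≤ 1 := by exact_mod_cast charParity_le_one χ
      rw [hx]; linarith
    have hq1 : (1 : ℝ) ≤ q := by exact_mod_cast Nat.one_le_iff_ne_zero.2 (NeZero.ne q)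
    have hqπ : (q : ℝ) / π ≤ q := div_le_self (by positivity) (by linarith [Real.pi_gt_three])
    calc ((q : ℝ) / π) ^ ((s.re + charParity χ) / 2) ≤ (q : ℝ) ^ ((s.re + charParity χ) / 2) :=
          Real.rpow_le_rpow (by positivity) hqπ ha0
      _ ≤ (q : ℝ) ^ x := Real.rpow_le_rpow_of_exponent_le hq1 ha1
      _ = Real.exp (Real.log q * x) := Real.rpow_def_of_pos (by positivity) x
      _ ≤ Real.exp (q * x ^ (3 / 2 : ℝ)) := by
          apply Real.exp_le_exp.2
          have hlq : Real.log q ≤ q := Real.log_le_self (by positivity)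
          nlinarith
  rw [norm_dirichletXi_eq h1 hs0]
  calc ‖χ.LFunction s‖ * ‖Complex.Gamma w‖ * ((q : ℝ) / π) ^ ((s.re + charParity χ) / 2)
      ≤ Real.exp (q * Z * x ^ (3 / 2 : ℝ)) * Real.exp (13 * x ^ (3 / 2 : ℝ)) *
          Real.exp (q * x ^ (3 / 2 : ℝ)) := by gcongr
    _ = Real.exp ((q * Z + 13 + q) * x ^ (3 / 2 : ℝ)) := by
        rw [← Real.exp_add, ← Real.exp_add]; ring_nf

/-- **Upper bound on the whole plane**: `|ξ(s, χ)| ≤ exp(K‖s‖^{3/2})` for `‖s‖ ≥ 3` (`χ` primitive,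
`χ ≠ 1`; `K` depending on `q` only). On `Re s < ½` reflect: `|ξ(s, χ)| = |ξ(1 − s̄, χ)|`, `Re(1 − s̄) > ½`.
(`ξ(s, χ)` is entire of order one, MV §10.1.) [cite: MontgomeryVaughan2007, §10.1 (Lemma 10.15, Cor 10.8)] -/
theorem exists_norm_dirichletXi_le_exp (hχ : χ.IsPrimitive) (h1 : χ ≠ 1) :
    ∃ K : ℝ, 0 ≤ K ∧ ∀ s : ℂ, 3 ≤ ‖s‖ → ‖dirichletXi χ s‖ ≤ Real.exp (K * ‖s‖ ^ (3 / 2 : ℝ)) := by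
  obtain ⟨K, hK0, hK⟩ := exists_norm_dirichletXi_le_exp_of_re h1
  refine ⟨(2 : ℝ) ^ (3 / 2 : ℝ) * K, by positivity, fun s h3 ↦ ?_⟩
  have h2K : K ≤ (2 : ℝ) ^ (3 / 2 : ℝ) * K := by
    have : (1 : ℝ) ≤ (2 : ℝ) ^ (3 / 2 : ℝ) := Real.one_le_rpow (by norm_num) (by norm_num)
    nlinarith
  have hx32 : 0 ≤ ‖s‖ ^ (3 / 2 : ℝ) := by positivity
  rcases le_or_gt (1 / 2 : ℝ) s.re with hle | hlt
  · refine (hK s hle (by linarith)).trans (Real.exp_le_exp.2 ?_)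
    exact mul_le_mul_of_nonneg_right h2K hx32
  · set s' : ℂ := 1 - conj s with hs'
    have hre' : 1 / 2 ≤ s'.re := by
      rw [hs']; simp only [Complex.sub_re, Complex.one_re, Complex.conj_re]; linarith
    have hn' : 2 ≤ ‖s'‖ := by
      have := norm_sub_norm_le (conj s) 1
      rw [Complex.norm_conj, norm_one, norm_sub_rev] at this
      rw [hs']; linarith
    have hn'' : ‖s'‖ ≤ 2 * ‖s‖ := by
      have := norm_sub_le (1 : ℂ) (conj s)
      rw [Complex.norm_conj, norm_one] at this
      rw [hs']; linarith
    rw [← norm_dirichletXi_one_sub_conj hχ h1 s]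
    refine (hK s' hre' hn').trans (Real.exp_le_exp.2 ?_)
    calc K * ‖s'‖ ^ (3 / 2 : ℝ) ≤ K * (2 * ‖s‖) ^ (3 / 2 : ℝ) := by
          gcongr
      _ = (2 : ℝ) ^ (3 / 2 : ℝ) * K * ‖s‖ ^ (3 / 2 : ℝ) := by
          rw [Real.mul_rpow (by norm_num) (norm_nonneg _)]; ring

/-- **Lower bound** `exp(−K‖s‖^{3/2}) ≤ |ξ(s, χ)|` for `Re s ≥ 1`, `‖s‖ ≥ 3` (`χ ≠ 1`; `K` depending on `q`
only): `1/|L| ≪ log(q(|t|+4))` for `|t| ≥ 1` (MV Theorem 11.4) and `|L| ≥ (σ−1)/σ ≥ ½` for `|t| < 1`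
(then `σ ≥ 2`); Stirling for `Γ`; `(q/π)^{Re} ≥ (1/4)^{Re} ≥ e^{−3‖s‖}`.
[cite: MontgomeryVaughan2007, Theorem 11.4 with (10.19)] -/
theorem exists_exp_neg_le_norm_dirichletXi (h1 : χ ≠ 1) :
    ∃ K : ℝ, 0 ≤ K ∧ ∀ s : ℂ, 1 ≤ s.re → 3 ≤ ‖s‖ →
      Real.exp (-(K * ‖s‖ ^ (3 / 2 : ℝ))) ≤ ‖dirichletXi χ s‖ := by
  obtain ⟨D, hD, hDb⟩ := exists_norm_inv_LFunction_le
  refine ⟨D * (q + 5) + 1 + 13 + 3, by positivity, fun s hs h3 ↦ ?_⟩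
  have hs0 : 0 < s.re := by linarith
  set x : ℝ := ‖s‖ with hx
  have hx1 : 1 ≤ x := by linarith
  have hx0 : 0 < x := by linarith
  have h32 : x ≤ x ^ (3 / 2 : ℝ) := by
    have := Real.rpow_le_rpow_of_exponent_le hx1 (show (1 : ℝ) ≤ 3 / 2 by norm_num)
    rwa [Real.rpow_one] at this
  have h032 : 1 ≤ x ^ (3 / 2 : ℝ) := Real.one_le_rpow hx1 (by norm_num)
  obtain ⟨hwlo, hwhi⟩ := norm_half_add_parity_bounds (χ := χ) hs0.le hx1
  set w : ℂ := (s + charParity χ) / 2 with hw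
  have hwre : 0 < w.re := by
    rw [hw]
    simp only [Complex.div_ofNat_re, Complex.add_re, Complex.natCast_re]
    linarith [(charParity χ).cast_nonneg (α := ℝ)]
  have hw1 : 1 ≤ ‖w‖ := by linarith
  have hq1 : (1 : ℝ) ≤ q := by exact_mod_cast Nat.one_le_iff_ne_zero.2 (NeZero.ne q)
  -- factor 1: `L(s, χ)`
  have hL : Real.exp (-((D * (q + 5) + 1) * x ^ (3 / 2 : ℝ))) ≤ ‖χ.LFunction s‖ := by
    rcases le_or_gt 1 |s.im| with ht | ht
    · obtain ⟨hne, hinv⟩ := hDb q χ h1 s hs ht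
      have hLpos : 0 < ‖χ.LFunction s‖ := norm_pos_iff.2 hne
      have hℒ : Real.log q + Real.log (|s.im| + 4) ≤ q + 4 + x := by
        have h1' : Real.log q ≤ q := Real.log_le_self (Nat.cast_nonneg q)
        have h2' : Real.log (|s.im| + 4) ≤ |s.im| + 4 := Real.log_le_self (by positivity)
        have h3' : |s.im| ≤ x := Complex.abs_im_le_norm s
        linarith
      have hy : ‖χ.LFunction s‖⁻¹ ≤ D * (q + 5) * x := by
        rw [← norm_inv]
        refine hinv.trans ?_
        have hqx : (q : ℝ) + 4 + x ≤ (q + 5) * x := by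
          nlinarith [mul_nonneg (by positivity : (0 : ℝ) ≤ q + 4) (by linarith : (0 : ℝ) ≤ x - 1)]
        calc D * (Real.log q + Real.log (|s.im| + 4)) ≤ D * (q + 4 + x) := by gcongr
          _ ≤ D * ((q + 5) * x) := by gcongr
          _ = D * (q + 5) * x := by ring
      have hT0 : 0 < D * (q + 5) * x := by positivity
      calc Real.exp (-((D * (q + 5) + 1) * x ^ (3 / 2 : ℝ))) ≤ Real.exp (-(D * (q + 5) * x)) := by
            apply Real.exp_le_exp.2
            nlinarith
        _ ≤ (D * (q + 5) * x)⁻¹ := by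
            rw [Real.exp_neg]
            exact inv_anti₀ hT0 (by linarith [Real.add_one_le_exp (D * (q + 5) * x)])
        _ ≤ ‖χ.LFunction s‖ := inv_le_of_inv_le₀ hLpos hy
    · have hre2 : 2 ≤ s.re := by
        have := Complex.norm_le_abs_re_add_abs_im s
        rw [abs_of_pos hs0] at this
        linarith
      have hlow := norm_LFunction_ge χ (by linarith : 1 < s.re)
      have hhalf : (1 : ℝ) / 2 ≤ (s.re - 1) / s.re := by
        rw [div_le_div_iff₀ (by norm_num) (by linarith)]
        linarith
      calc Real.exp (-((D * (q + 5) + 1) * x ^ (3 / 2 : ℝ))) ≤ Real.exp (-1) := by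
            apply Real.exp_le_exp.2
            have : (1 : ℝ) ≤ (D * (q + 5) + 1) * x ^ (3 / 2 : ℝ) := by
              nlinarith [mul_nonneg (by positivity : (0 : ℝ) ≤ D * (q + 5))
                (by positivity : (0 : ℝ) ≤ x ^ (3 / 2 : ℝ))]
            linarith
        _ ≤ 1 / 2 := by
            rw [Real.exp_neg]
            have h2 : (2 : ℝ) ≤ Real.exp 1 := by linarith [Real.add_one_le_exp (1 : ℝ)]
            rw [one_div]
            exact inv_anti₀ (by norm_num) h2
        _ ≤ ‖χ.LFunction s‖ := hhalf.trans hlow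
  -- factor 2: `Γ((s+κ)/2)`
  have hG : Real.exp (-(13 * x ^ (3 / 2 : ℝ))) ≤ ‖Complex.Gamma w‖ := by
    refine (Real.exp_le_exp.2 ?_).trans (exp_neg_le_norm_Gamma hwre hw1)
    have : ‖w‖ ^ (3 / 2 : ℝ) ≤ x ^ (3 / 2 : ℝ) := Real.rpow_le_rpow (norm_nonneg _) hwhi (by norm_num)
    linarith
  -- factor 3: `(q/π)^{(σ+κ)/2}`
  have hP : Real.exp (-(3 * x ^ (3 / 2 : ℝ))) ≤ ((q : ℝ) / π) ^ ((s.re + charParity χ) / 2) := by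
    have ha0 : 0 ≤ (s.re + charParity χ) / 2 := by
      linarith [(charParity χ).cast_nonneg (α := ℝ)]
    have ha1 : (s.re + charParity χ) / 2 ≤ x := by
      have hre : s.re ≤ ‖s‖ := Complex.re_le_norm s
      have hκ : (charParity χ : ℝ) ≤ 1 := by exact_mod_cast charParity_le_one χ
      rw [hx]; linarith
    have hq4 : (1 : ℝ) / 4 ≤ q / π := by
      rw [div_le_div_iff₀ (by norm_num) Real.pi_pos]
      nlinarith [Real.pi_le_four]
    have hl4 : -3 ≤ Real.log (1 / 4) := by
      rw [one_div, Real.log_inv]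
      have := Real.log_le_sub_one_of_pos (by norm_num : (0 : ℝ) < 4)
      linarith
    calc Real.exp (-(3 * x ^ (3 / 2 : ℝ))) ≤ Real.exp (Real.log (1 / 4) * ((s.re + charParity χ) / 2)) := by
          apply Real.exp_le_exp.2
          nlinarith
      _ = (1 / 4 : ℝ) ^ ((s.re + charParity χ) / 2) := (Real.rpow_def_of_pos (by norm_num) _).symm
      _ ≤ ((q : ℝ) / π) ^ ((s.re + charParity χ) / 2) := Real.rpow_le_rpow (by norm_num) hq4 ha0
  rw [norm_dirichletXi_eq h1 hs0]
  calc Real.exp (-((D * (q + 5) + 1 + 13 + 3) * x ^ (3 / 2 : ℝ)))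
      = Real.exp (-((D * (q + 5) + 1) * x ^ (3 / 2 : ℝ))) * Real.exp (-(13 * x ^ (3 / 2 : ℝ))) *
          Real.exp (-(3 * x ^ (3 / 2 : ℝ))) := by
        rw [← Real.exp_add, ← Real.exp_add]; ring_nf
    _ ≤ ‖χ.LFunction s‖ * ‖Complex.Gamma w‖ * ((q : ℝ) / π) ^ ((s.re + charParity χ) / 2) := by
        gcongr

/-! ## The quotient `ξ(½ − h + x, χ)/ξ(½ + h + x, χ)` on the positive real axis -/

/-- The modulus of `ξ(σ, χ)` at a real point `σ > 0`: `|L(σ, χ)| · Γ((σ+κ)/2) · (q/π)^{(σ+κ)/2}`.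
[cite: MontgomeryVaughan2007, (10.19)] -/
theorem norm_dirichletXi_ofReal (h1 : χ ≠ 1) {σ : ℝ} (hσ : 0 < σ) :
    ‖dirichletXi χ σ‖ = ‖χ.LFunction σ‖ * Real.Gamma ((σ + charParity χ) / 2) *
      ((q : ℝ) / π) ^ ((σ + charParity χ) / 2) := by
  have hu0 : 0 < (σ + charParity χ) / 2 := by
    have : (0 : ℝ) ≤ charParity χ := (charParity χ).cast_nonneg
    linarith
  rw [norm_dirichletXi_eq h1 (by simpa using hσ)]
  have : ((σ : ℂ) + (charParity χ : ℂ)) / 2 = (((σ + charParity χ) / 2 : ℝ) : ℂ) :=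
    Complex.ext (by simp) (by simp)
  rw [this, Complex.Gamma_ofReal, Complex.norm_real, Real.norm_of_nonneg (Real.Gamma_pos_of_pos hu0).le,
    Complex.ofReal_re]

/-- **`ξ(½ − h + x, χ)/ξ(½ + h + x, χ) → 0` as `x → +∞`** along the reals (`h ≥ ½`): to the right of `2`
one has `|L| ≤ 2` and `|L| ≥ ½`, the powers of `q/π` contribute the constant `(q/π)^{−h}`, and
`Γ(u)/Γ(u + h) ≤ (u − ½)^{−1/2}` (`u = (x + ½ − h + κ)/2 ≥ 2`). [folklore] -/
private theorem tendsto_dirichletXi_shift_div_atTop (h1 : χ ≠ 1) {h : ℝ} (hh : 1 / 2 ≤ h) :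
    Tendsto (fun x : ℝ ↦ dirichletXi χ ((1 / 2 : ℂ) - h + x) / dirichletXi χ ((1 / 2 : ℂ) + h + x))
      atTop (𝓝 0) := by
  set P : ℝ := (q : ℝ) / π with hP
  have hP0 : 0 < P := div_pos (Nat.cast_pos.2 (NeZero.pos q)) Real.pi_pos
  set A : ℝ := 4 * P ^ (-h) with hA
  have hκ1 : (charParity χ : ℝ) ≤ 1 := by exact_mod_cast charParity_le_one χ
  have hκ0 : (0 : ℝ) ≤ charParity χ := (charParity χ).cast_nonneg
  -- the bound for `x ≥ h + 4`
  have hb : ∀ x : ℝ, h + 4 ≤ x →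
      ‖dirichletXi χ ((1 / 2 : ℂ) - h + x) / dirichletXi χ ((1 / 2 : ℂ) + h + x)‖ ≤
        A * ((x - h - 1 / 2) / 2) ^ (-(1 / 2 : ℝ)) := by
    intro x hx
    have hσ₁ : 2 ≤ 1 / 2 - h + x := by linarith
    have hσ₂ : 2 ≤ 1 / 2 + h + x := by linarith
    set u : ℝ := (1 / 2 - h + x + charParity χ) / 2 with hu
    have hu2 : 2 ≤ u := by rw [hu]; linarith
    -- the two moduli through (10.19)
    have hN : ‖dirichletXi χ ((1 / 2 : ℂ) - h + x)‖ =
        ‖χ.LFunction ((1 / 2 - h + x : ℝ) : ℂ)‖ * Real.Gamma u * P ^ u := by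
      have e1 : ((1 / 2 : ℂ) - h + x) = ((1 / 2 - h + x : ℝ) : ℂ) := Complex.ext (by simp) (by simp)
      rw [e1, norm_dirichletXi_ofReal h1 (by linarith), ← hu, ← hP]
    have hD : ‖dirichletXi χ ((1 / 2 : ℂ) + h + x)‖ =
        ‖χ.LFunction ((1 / 2 + h + x : ℝ) : ℂ)‖ * Real.Gamma (u + h) * P ^ (u + h) := by
      have e2 : ((1 / 2 : ℂ) + h + x) = ((1 / 2 + h + x : ℝ) : ℂ) := Complex.ext (by simp) (by simp)
      have huh : (1 / 2 + h + x + (charParity χ : ℝ)) / 2 = u + h := by rw [hu]; ring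
      rw [e2, norm_dirichletXi_ofReal h1 (by linarith), huh, ← hP]
    -- factor bounds
    have hLx : ‖χ.LFunction ((1 / 2 - h + x : ℝ) : ℂ)‖ ≤ 2 := by
      have hs : 1 < (((1 / 2 - h + x : ℝ)) : ℂ).re := by simp only [Complex.ofReal_re]; linarith
      rw [DirichletCharacter.LFunction_eq_LSeries χ hs]
      refine (norm_LSeries_le_of_norm_le_one (fun n ↦ DirichletCharacter.norm_le_one χ _) hs).trans ?_
      simp only [Complex.ofReal_re]
      rw [div_le_iff₀ (by linarith)]
      linarith
    have hLx1 : 1 / 2 ≤ ‖χ.LFunction ((1 / 2 + h + x : ℝ) : ℂ)‖ := by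
      have hs : 1 < (((1 / 2 + h + x : ℝ)) : ℂ).re := by simp only [Complex.ofReal_re]; linarith
      refine le_trans ?_ (norm_LFunction_ge χ hs)
      simp only [Complex.ofReal_re]
      rw [div_le_div_iff₀ (by norm_num) (by linarith)]
      linarith
    have hΓ := real_Gamma_le_rpow_mul_Gamma_add hu2 hh
    have hΓpos : 0 < Real.Gamma (u + h) := Real.Gamma_pos_of_pos (by linarith)
    have hPu : 0 < P ^ u := Real.rpow_pos_of_pos hP0 u
    have hPu' : 0 < P ^ (u + h) := Real.rpow_pos_of_pos hP0 _
    have hr0 : 0 < (u - 1 / 2) ^ (-(1 / 2 : ℝ)) := Real.rpow_pos_of_pos (by linarith) _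
    have hNle : ‖χ.LFunction ((1 / 2 - h + x : ℝ) : ℂ)‖ * Real.Gamma u * P ^ u ≤
        2 * ((u - 1 / 2) ^ (-(1 / 2 : ℝ)) * Real.Gamma (u + h)) * P ^ u := by
      gcongr
    have hDle : 1 / 2 * Real.Gamma (u + h) * P ^ (u + h) ≤
        ‖χ.LFunction ((1 / 2 + h + x : ℝ) : ℂ)‖ * Real.Gamma (u + h) * P ^ (u + h) := by
      gcongr
    have hDb0 : 0 < 1 / 2 * Real.Gamma (u + h) * P ^ (u + h) := by positivity
    have hPP : P ^ (-h) * P ^ (u + h) = P ^ u := by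
      rw [← Real.rpow_add hP0]; congr 1; ring
    have hkey : 2 * ((u - 1 / 2) ^ (-(1 / 2 : ℝ)) * Real.Gamma (u + h)) * P ^ u =
        (A * (u - 1 / 2) ^ (-(1 / 2 : ℝ))) * (1 / 2 * Real.Gamma (u + h) * P ^ (u + h)) := by
      rw [hA, ← hPP]; ring
    have hux : (x - h - 1 / 2) / 2 ≤ u - 1 / 2 := by
      rw [hu]; linarith [(charParity χ).cast_nonneg (α := ℝ)]
    have hux0 : 0 < (x - h - 1 / 2) / 2 := by linarith
    rw [norm_div, hN, hD]
    calc ‖χ.LFunction ((1 / 2 - h + x : ℝ) : ℂ)‖ * Real.Gamma u * P ^ u /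
          (‖χ.LFunction ((1 / 2 + h + x : ℝ) : ℂ)‖ * Real.Gamma (u + h) * P ^ (u + h))
        ≤ (2 * ((u - 1 / 2) ^ (-(1 / 2 : ℝ)) * Real.Gamma (u + h)) * P ^ u) /
            (1 / 2 * Real.Gamma (u + h) * P ^ (u + h)) :=
          div_le_div₀ (by positivity) hNle hDb0 hDle
      _ = A * (u - 1 / 2) ^ (-(1 / 2 : ℝ)) := by
          rw [hkey, mul_div_assoc, div_self hDb0.ne', mul_one]
      _ ≤ A * ((x - h - 1 / 2) / 2) ^ (-(1 / 2 : ℝ)) := by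
          have hA0 : 0 ≤ A := by positivity
          refine mul_le_mul_of_nonneg_left ?_ hA0
          exact Real.rpow_le_rpow_of_nonpos hux0 hux (by norm_num)
  have ht1 : Tendsto (fun x : ℝ ↦ (x - h - 1 / 2) / 2) atTop atTop := by
    have h0 := (tendsto_atTop_add_const_right atTop (-(h + 1 / 2)) tendsto_id).atTop_div_const
      (show (0 : ℝ) < 2 by norm_num)
    refine h0.congr fun x ↦ ?_
    simp only [id_eq]
    ring
  have ht2 : Tendsto (fun x : ℝ ↦ ((x - h - 1 / 2) / 2) ^ (-(1 / 2 : ℝ))) atTop (𝓝 0) :=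
    (tendsto_rpow_neg_atTop (by norm_num : (0 : ℝ) < 1 / 2)).comp ht1
  have ht3 : Tendsto (fun x : ℝ ↦ A * ((x - h - 1 / 2) / 2) ^ (-(1 / 2 : ℝ))) atTop (𝓝 0) := by
    simpa using ht2.const_mul A
  refine squeeze_zero_norm' ?_ ht3
  filter_upwards [eventually_ge_atTop (h + 4)] with x hx using hb x hx

/-! ## The shift inequality `|ξ(½ − h + z, χ)| < |ξ(½ + h + z, χ)|` on `Re z > 0` -/

/-- **`|ξ(½ − h + z, χ)| < |ξ(½ + h + z, χ)|` for `Re z > 0`, `h ≥ ½`** (`χ` primitive, `χ ≠ 1`) — the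
Dirichlet analogue of Lagarias' Lemma 2.1 (1) in the centred variable (for `h = ½` this is the tree's
`DeBranges1986.norm_dirichletXi_lt_norm_dirichletXi_add_one`). Proof (Phragmén–Lindelöf in place of the
Hadamard product (5.4)): `g = ξ(½ − h + ·, χ)/ξ(½ + h + ·, χ)` is holomorphic on `Re z ≥ 0` (the denominator
has real part `≥ 1`), `|g| = 1` on `Re z = 0` (`ξ(1 − s̄, χ) = ε(χ) conj ξ(s, χ)` with `s = ½ + h + iy`),
`g(x) → 0` along the reals, and `|g(z)| ≤ exp(B|z|^{3/2})` on the half-plane, so `|g| ≤ 1` by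
Phragmén–Lindelöf and `< 1` by the maximum modulus principle.
[cite: Lagarias2005, Lemma 5.1 (1) and its proof (arXiv p. 10; held text p0010 L28–72)] -/
theorem norm_dirichletXi_shift_lt (hχ : χ.IsPrimitive) (h1 : χ ≠ 1) {h : ℝ} (hh : 1 / 2 ≤ h) {z : ℂ}
    (hz : 0 < z.re) :
    ‖dirichletXi χ ((1 / 2 : ℂ) - h + z)‖ < ‖dirichletXi χ ((1 / 2 : ℂ) + h + z)‖ := by
  have hne : ∀ w : ℂ, 0 ≤ w.re → dirichletXi χ ((1 / 2 : ℂ) + h + w) ≠ 0 := fun w hw ↦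
    dirichletXi_ne_zero_of_not_mem_strip hχ h1
      (Or.inr (by simp only [Complex.add_re, Complex.ofReal_re, Complex.div_ofNat_re, Complex.one_re]; linarith))
  set g : ℂ → ℂ := fun w ↦ dirichletXi χ ((1 / 2 : ℂ) - h + w) / dirichletXi χ ((1 / 2 : ℂ) + h + w)
    with hg
  have hdiff : Differentiable ℂ (dirichletXi χ) := differentiable_dirichletXi h1
  have hdiffN : Differentiable ℂ (fun w : ℂ ↦ dirichletXi χ ((1 / 2 : ℂ) - h + w)) :=
    hdiff.comp ((differentiable_const _).add differentiable_id)
  have hdiffD : Differentiable ℂ (fun w : ℂ ↦ dirichletXi χ ((1 / 2 : ℂ) + h + w)) :=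
    hdiff.comp ((differentiable_const _).add differentiable_id)
  -- (1) holomorphic on the open half-plane, continuous on the closed one
  have hd : DiffContOnCl ℂ g {w : ℂ | 0 < w.re} := by
    refine ⟨hdiffN.differentiableOn.div hdiffD.differentiableOn fun w hw ↦ hne w (le_of_lt hw), ?_⟩
    rw [closure_setOf_lt_re]
    exact hdiffN.continuous.continuousOn.div hdiffD.continuous.continuousOn fun w hw ↦ hne w hw
  -- (2) growth `exp(B |w|^{3/2})`
  obtain ⟨K₁, hK₁0, hK₁⟩ := exists_norm_dirichletXi_le_exp hχ h1
  obtain ⟨K₂, hK₂0, hK₂⟩ := exists_exp_neg_le_norm_dirichletXi (χ := χ) h1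
  have hnh : ‖(h : ℂ)‖ = h := by rw [Complex.norm_real, Real.norm_of_nonneg (by linarith)]
  have hhalf : ‖(1 / 2 : ℂ)‖ = 1 / 2 := by norm_num
  have hc : ‖((1 / 2 : ℂ) + h)‖ ≤ h + 1 / 2 := by
    have e := norm_add_le (1 / 2 : ℂ) (h : ℂ)
    rw [hnh, hhalf] at e
    linarith
  have hc' : ‖((1 / 2 : ℂ) - h)‖ ≤ h + 1 / 2 := by
    have e := norm_sub_le (1 / 2 : ℂ) (h : ℂ)
    rw [hnh, hhalf] at e
    linarith
  have hexp : ∃ c < (2 : ℝ), ∃ B, g =O[Bornology.cobounded ℂ ⊓ 𝓟 {w : ℂ | 0 < w.re}]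
      fun w ↦ Real.exp (B * ‖w‖ ^ c) := by
    refine ⟨3 / 2, by norm_num, (2 : ℝ) ^ (3 / 2 : ℝ) * (K₁ + K₂), ?_⟩
    refine Asymptotics.IsBigO.of_bound 1 ?_
    rw [Filter.eventually_inf_principal]
    refine ((Metric.hasBasis_cobounded_compl_closedBall (0 : ℂ)).eventually_iff).2
      ⟨2 * h + 4, trivial, fun w hw hw' ↦ ?_⟩
    have hw4 : 2 * h + 4 < ‖w‖ := by
      simpa [Metric.mem_closedBall, dist_zero_right] using hw
    have hw' : 0 < w.re := hw'
    rw [one_mul, Real.norm_of_nonneg (Real.exp_pos _).le]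
    -- sizes of the two arguments
    have hN3 : 3 ≤ ‖(1 / 2 : ℂ) - h + w‖ := by
      have e : (1 / 2 : ℂ) - h + w = w - (-((1 / 2 : ℂ) - h)) := by ring
      have h2 := norm_sub_norm_le w (-((1 / 2 : ℂ) - h))
      rw [norm_neg] at h2
      rw [e]; linarith
    have hNle : ‖(1 / 2 : ℂ) - h + w‖ ≤ 2 * ‖w‖ := by
      refine (norm_add_le _ _).trans ?_
      linarith
    have hD3 : 3 ≤ ‖(1 / 2 : ℂ) + h + w‖ := by
      have e : (1 / 2 : ℂ) + h + w = w - (-((1 / 2 : ℂ) + h)) := by ring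
      have h2 := norm_sub_norm_le w (-((1 / 2 : ℂ) + h))
      rw [norm_neg] at h2
      rw [e]; linarith
    have hDle : ‖(1 / 2 : ℂ) + h + w‖ ≤ 2 * ‖w‖ := by
      refine (norm_add_le _ _).trans ?_
      linarith
    have hDre : 1 ≤ ((1 / 2 : ℂ) + h + w).re := by
      simp only [Complex.add_re, Complex.ofReal_re, Complex.div_ofNat_re, Complex.one_re]; linarith
    have hN := hK₁ _ hN3
    have hD := hK₂ _ hDre hD3
    have h2w : (2 * ‖w‖) ^ (3 / 2 : ℝ) = (2 : ℝ) ^ (3 / 2 : ℝ) * ‖w‖ ^ (3 / 2 : ℝ) :=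
      Real.mul_rpow (by norm_num) (norm_nonneg _)
    calc ‖g w‖ = ‖dirichletXi χ ((1 / 2 : ℂ) - h + w)‖ / ‖dirichletXi χ ((1 / 2 : ℂ) + h + w)‖ := norm_div _ _
      _ ≤ Real.exp (K₁ * ‖(1 / 2 : ℂ) - h + w‖ ^ (3 / 2 : ℝ)) /
            Real.exp (-(K₂ * ‖(1 / 2 : ℂ) + h + w‖ ^ (3 / 2 : ℝ))) :=
          div_le_div₀ (Real.exp_pos _).le hN (Real.exp_pos _) hD
      _ = Real.exp (K₁ * ‖(1 / 2 : ℂ) - h + w‖ ^ (3 / 2 : ℝ) + K₂ * ‖(1 / 2 : ℂ) + h + w‖ ^ (3 / 2 : ℝ)) := by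
          rw [Real.exp_neg, div_inv_eq_mul, Real.exp_add]
      _ ≤ Real.exp ((2 : ℝ) ^ (3 / 2 : ℝ) * (K₁ + K₂) * ‖w‖ ^ (3 / 2 : ℝ)) := by
          apply Real.exp_le_exp.2
          have a := Real.rpow_le_rpow (norm_nonneg _) hNle (show (0 : ℝ) ≤ 3 / 2 by norm_num)
          have b := Real.rpow_le_rpow (norm_nonneg _) hDle (show (0 : ℝ) ≤ 3 / 2 by norm_num)
          rw [h2w] at a b
          nlinarith [mul_le_mul_of_nonneg_left a hK₁0, mul_le_mul_of_nonneg_left b hK₂0]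
  -- (3) decay along the positive real axis
  have hre : Tendsto (fun x : ℝ ↦ g x) atTop (𝓝 0) := tendsto_dirichletXi_shift_div_atTop h1 hh
  -- (4) modulus one on the imaginary axis
  have him : ∀ y : ℝ, ‖g (y * I)‖ ≤ 1 := by
    intro y
    have heq : ‖dirichletXi χ ((1 / 2 : ℂ) - h + y * I)‖ = ‖dirichletXi χ ((1 / 2 : ℂ) + h + y * I)‖ := by
      have e : (1 : ℂ) - conj ((1 / 2 : ℂ) + h + y * I) = (1 / 2 : ℂ) - h + y * I := by
        simp only [map_add, map_mul, Complex.conj_ofReal, Complex.conj_I, map_div₀, map_one, map_ofNat]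
        ring
      rw [← e, norm_dirichletXi_one_sub_conj hχ h1]
    show ‖dirichletXi χ ((1 / 2 : ℂ) - h + y * I) / dirichletXi χ ((1 / 2 : ℂ) + h + y * I)‖ ≤ 1
    rw [norm_div, heq]
    exact div_self_le_one _
  -- Phragmén–Lindelöf: `|g| ≤ 1` on the closed half-plane
  have hle : ∀ w : ℂ, 0 ≤ w.re → ‖g w‖ ≤ 1 := fun w hw ↦
    PhragmenLindelof.right_half_plane_of_tendsto_zero_on_real hd hexp hre him hw
  -- strictness via the maximum modulus principle
  have hz1 : 0 < ‖dirichletXi χ ((1 / 2 : ℂ) + h + z)‖ := norm_pos_iff.2 (hne z hz.le)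
  by_contra hcon
  have hge : ‖dirichletXi χ ((1 / 2 : ℂ) + h + z)‖ ≤ ‖dirichletXi χ ((1 / 2 : ℂ) - h + z)‖ := not_lt.1 hcon
  have hgz : ‖g z‖ = 1 := by
    refine le_antisymm (hle z hz.le) ?_
    show 1 ≤ ‖dirichletXi χ ((1 / 2 : ℂ) - h + z) / dirichletXi χ ((1 / 2 : ℂ) + h + z)‖
    rw [norm_div, le_div_iff₀ hz1, one_mul]
    exact hge
  have hU : IsOpen {w : ℂ | 0 < w.re} := isOpen_lt continuous_const Complex.continuous_re
  have hUc : IsPreconnected {w : ℂ | 0 < w.re} := (convex_halfSpace_re_gt 0).isPreconnected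
  have hmax : IsMaxOn (norm ∘ g) {w : ℂ | 0 < w.re} z := fun w hw ↦ by
    simp only [Set.mem_setOf_eq, Function.comp_apply, hgz]
    exact hle w (le_of_lt hw)
  have heq := Complex.eqOn_of_isPreconnected_of_isMaxOn_norm hUc hU hd.differentiableOn hz hmax
  have hev : ∀ᶠ x : ℝ in atTop, ‖g x‖ < 1 / 2 := by
    have hn := hre.norm
    rw [norm_zero] at hn
    exact hn.eventually (gt_mem_nhds (by norm_num))
  obtain ⟨x, hx1, hx2⟩ := (hev.and (eventually_gt_atTop 0)).exists
  have hxU : (x : ℂ) ∈ {w : ℂ | 0 < w.re} := by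
    simpa only [Set.mem_setOf_eq, Complex.ofReal_re] using hx2
  have hgx : g x = g z := heq hxU
  rw [hgx, hgz] at hx1
  linarith

/-- **`|ξ(s − h, χ)| < |ξ(s + h, χ)|` for `Re s > ½`, `h ≥ ½`** (`χ` primitive, `χ ≠ 1`): Lagarias'
inequality (5.3) with its right-hand side rewritten by the reflection formula
(`|E_h(1 − s̄, χ)| = |ξ(1 − s̄ + h, χ)| = |ξ(s − h, χ)|`). RH-FREE.
[cite: Lagarias2005, Lemma 5.1 (1) (arXiv p. 10; held text p0010 L28–36)] -/
theorem norm_dirichletXi_sub_lt_norm_dirichletXi_add (hχ : χ.IsPrimitive) (h1 : χ ≠ 1) {h : ℝ}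
    (hh : 1 / 2 ≤ h) {s : ℂ} (hs : 1 / 2 < s.re) :
    ‖dirichletXi χ (s - h)‖ < ‖dirichletXi χ (s + h)‖ := by
  have hz : 0 < (s - 1 / 2).re := by
    simp only [Complex.sub_re, Complex.div_ofNat_re, Complex.one_re]; linarith
  have key := norm_dirichletXi_shift_lt hχ h1 hh hz
  have e1 : (1 / 2 : ℂ) - h + (s - 1 / 2) = s - h := by ring
  have e2 : (1 / 2 : ℂ) + h + (s - 1 / 2) = s + h := by ring
  rwa [e1, e2] at key

end Lagarias2005Char

/-! ## Lemma 5.1 (1) -/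

section Dirichlet

open Lagarias2005Char

variable {N : ℕ} [NeZero N] {χ : DirichletCharacter ℂ N}

/-- The reflected value of `E_h(·, χ)` has modulus `|E_h(1 − s̄, χ)| = |ξ(s − h, χ)|` (primitive `χ ≠ 1`;
`ξ(1 − s̄ + h, χ) = ε(χ) conj ξ(s − h, χ)`, `|ε(χ)| = 1`).
[cite: Lagarias2005, §5 p.10 (proof of Lemma 5.1)] -/
theorem norm_diffXiCharE_one_sub_conj (hχ : χ.IsPrimitive) (h1 : χ ≠ 1) (h : ℝ) (s : ℂ) :
    ‖diffXiCharE χ h (1 - conj s)‖ = ‖dirichletXi χ (s - h)‖ := by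
  rw [diffXiCharE_apply]
  have e : (1 : ℂ) - conj s + h = 1 - conj (s - h) := by
    simp only [map_sub, Complex.conj_ofReal]; ring
  rw [e, norm_dirichletXi_one_sub_conj hχ h1]

/-- **Lagarias 2005, Lemma 5.1 (1)** — discharge of `lagarias2005_lemma_5_1_1` (RH-FREE): for a primitive
non-principal `χ` and `h ≥ ½`, `|E_h(s, χ)| > |E_h(1 − s̄, χ)|` for `Re(s) > ½`. Printed proof: Hadamard
product (5.4) for `ξ(s, χ)` zero by zero ("similar to Lemma 2.1"); proved here by the Phragmén–Lindelöf road
of `Lagarias2005Char.norm_dirichletXi_shift_lt` (the tree has no Hadamard product for `ξ(s, χ)`; the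
statement proved is exactly the printed one). [cite: Lagarias2005, Lemma 5.1 (1) (arXiv p. 10; held text p0010 L28–36)] -/
theorem lagarias2005_lemma_5_1_1_holds : lagarias2005_lemma_5_1_1 := by
  intro N _ χ hχ h1 h hh s hs
  rw [norm_diffXiCharE_one_sub_conj hχ h1, diffXiCharE_apply]
  exact norm_dirichletXi_sub_lt_norm_dirichletXi_add hχ h1 hh hs

/-! ## Theorem 5.1 (1) -/

/-- `E_{h,θ}(·, χ)` satisfies hypothesis (2.6) of Lemma 2.2 for `h ≥ ½` ("using Lemma 5.1 in place of Lemma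
2.1"; the rotation by `e^{iθ}` does not change moduli). RH-FREE.
[cite: Lagarias2005, Theorem 5.1, proof (arXiv p. 10; held text p0010 L101–104)] -/
theorem diffXiCharErot_critHB (hχ : χ.IsPrimitive) (h1 : χ ≠ 1) {h : ℝ} (hh : 1 / 2 ≤ h) (θ : ℝ) :
    ∀ s : ℂ, 1 / 2 < s.re → ‖diffXiCharErot χ h θ (1 - conj s)‖ < ‖diffXiCharErot χ h θ s‖ := by
  intro s hs
  have key := lagarias2005_lemma_5_1_1_holds N χ hχ h1 h hh s hs
  have hθ : ‖Complex.exp (θ * I)‖ = 1 := by rw [Complex.norm_exp]; simp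
  rw [diffXiCharErot_apply, diffXiCharErot_apply, norm_mul, norm_mul, hθ, one_mul, one_mul]
  exact key

/-- `E_{h,θ}(½ + it, χ) = e^{iθ} ξ(½ + h + it, χ) ≠ 0` for `h ≥ ½` (`Re(½ + h + it) ≥ 1`, outside the open
critical strip). [cite: Lagarias2005, Theorem 5.1, proof (arXiv p. 10); MontgomeryVaughan2007, Cor 10.8] -/
theorem diffXiCharErot_critLine_ne_zero (hχ : χ.IsPrimitive) (h1 : χ ≠ 1) {h : ℝ} (hh : 1 / 2 ≤ h)
    (θ t : ℝ) : diffXiCharErot χ h θ (1 / 2 + t * I) ≠ 0 := by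
  rw [diffXiCharErot_apply, diffXiCharE_apply]
  refine mul_ne_zero (Complex.exp_ne_zero _) (dirichletXi_ne_zero_of_not_mem_strip hχ h1 (Or.inr ?_))
  simp only [Complex.add_re, Complex.div_ofNat_re, Complex.one_re, Complex.mul_re, Complex.ofReal_re,
    Complex.I_re, Complex.ofReal_im, Complex.I_im, mul_zero, mul_one, sub_self, add_zero]
  linarith

/-- A point with `Re s = ½` is `½ + i·Im s`. [folklore] -/
private theorem eq_critLine_of_re' {s : ℂ} (hs : s.re = 1 / 2) : s = 1 / 2 + (s.im : ℝ) * I :=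
  Complex.ext (by simp [hs]) (by simp)

/-- **Theorem 5.1 for `h ≥ ½` and every real `θ`**: all zeros of `A_{h,θ}(·, χ)` and `B_{h,θ}(·, χ)` lie on
the critical line, are simple, and interlace — Lemma 5.1 (1) + Lemma 2.2 (`lagarias2005_lemma_2_2_zeros`,
`lagarias2005_lemma_2_2_interlace_holds`), simplicity from `E_{h,θ}(½ + it, χ) ≠ 0` and the strict phase
velocity (`deriv_critRePart_ne_zero_of_ne`, `deriv_critImPart_ne_zero_of_ne`). RH-FREE.
[cite: Lagarias2005, Theorem 5.1 (1), proof (arXiv p. 10; held text p0010 L85–104)] -/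
theorem diffXiChar_zeroPattern (hχ : χ.IsPrimitive) (h1 : χ ≠ 1) {h : ℝ} (hh : 1 / 2 ≤ h) (θ : ℝ) :
    AllZerosOnCriticalLine (diffXiCharArot χ h θ) ∧ AllZerosOnCriticalLine (diffXiCharBrot χ h θ) ∧
      AllZerosSimple (diffXiCharArot χ h θ) ∧ AllZerosSimple (diffXiCharBrot χ h θ) ∧
        CritZerosInterlace (diffXiCharArot χ h θ) (diffXiCharBrot χ h θ) := by
  have hE : Differentiable ℂ (diffXiCharErot χ h θ) := differentiable_diffXiCharErot h1 h θ
  have hHB := diffXiCharErot_critHB hχ h1 hh θ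
  obtain ⟨hA, hB⟩ := lagarias2005_lemma_2_2_zeros hHB
  have hA' : AllZerosOnCriticalLine (diffXiCharArot χ h θ) := hA
  have hB' : AllZerosOnCriticalLine (diffXiCharBrot χ h θ) := hB
  refine ⟨hA', hB', ?_, ?_, lagarias2005_lemma_2_2_interlace_holds _ hE hHB⟩
  · intro s h0
    have hs : s = 1 / 2 + (s.im : ℝ) * I := eq_critLine_of_re' (hA' s h0)
    rw [hs] at h0 ⊢
    exact deriv_critRePart_ne_zero_of_ne hE hHB (diffXiCharErot_critLine_ne_zero hχ h1 hh θ s.im) h0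
  · intro s h0
    have hs : s = 1 / 2 + (s.im : ℝ) * I := eq_critLine_of_re' (hB' s h0)
    rw [hs] at h0 ⊢
    exact deriv_critImPart_ne_zero_of_ne hE hHB (diffXiCharErot_critLine_ne_zero hχ h1 hh θ s.im) h0

/-! ### The reduction `h ↦ −h` through the root number -/

/-- `A` is unchanged when `E` is replaced by `E♯` (`A = ½(E + E♯)`, `♯` an involution). [cite: Lagarias2005, Lemma 2.2 (statement), p.5] -/
theorem critRePart_critReflect (E : ℂ → ℂ) : critRePart (critReflect E) = critRePart E := by
  funext s
  rw [critRePart, critRePart, critReflect_critReflect, add_comm]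

/-- `B` changes sign when `E` is replaced by `E♯` (`B = (i/2)(E − E♯)`). [cite: Lagarias2005, Lemma 2.2 (statement), p.5] -/
theorem critImPart_critReflect (E : ℂ → ℂ) : critImPart (critReflect E) = -critImPart E := by
  funext s
  simp only [critImPart, critReflect_critReflect, Pi.neg_apply]
  ring

/-- `conj e^{iθ′} · conj ε(χ) = e^{iθ}` for the phase `θ′ := −θ − arg ε(χ)` (`|ε(χ)| = 1`, so
`ε(χ) = e^{i arg ε(χ)}`). [folklore] -/
private theorem conj_exp_negShiftAngle_mul (hχ : χ.IsPrimitive) (θ : ℝ) :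
    conj (Complex.exp (((-θ - Complex.arg χ.rootNumber : ℝ) : ℂ) * I)) * conj χ.rootNumber =
      Complex.exp (θ * I) := by
  have hε : ‖χ.rootNumber‖ = 1 := SelbergDirichlet.norm_rootNumber hχ
  have hpolar : Complex.exp ((Complex.arg χ.rootNumber : ℝ) * I) = χ.rootNumber := by
    have e := Complex.norm_mul_exp_arg_mul_I χ.rootNumber
    rwa [hε, Complex.ofReal_one, one_mul] at e
  have hconjε : conj χ.rootNumber = Complex.exp (-((Complex.arg χ.rootNumber : ℝ) * I)) := by
    conv_lhs => rw [← hpolar]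
    rw [← Complex.exp_conj, map_mul, Complex.conj_ofReal, Complex.conj_I]
    congr 1
    ring
  rw [hconjε, ← Complex.exp_conj, ← Complex.exp_add]
  congr 1
  simp only [map_mul, Complex.conj_ofReal, Complex.conj_I]
  push_cast
  ring

/-- **`E_{−h,θ}(·, χ) = (E_{h,θ′}(·, χ))♯`** with `θ′ = −θ − arg ε(χ)`: by the reflection formula
`ξ(1 − s̄ + h, χ) = ε(χ) conj ξ(s − h, χ)`. For `χ = 1` formally (`ε = 1`) this is the `ζ`-case identity
behind `diffXiA_neg`/`diffXiB_neg`. [cite: Lagarias2005, §5 p.10 (functional equation ξ(s,χ) = … and proof of Lemma 5.1)] -/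
theorem diffXiCharErot_neg_eq_critReflect (hχ : χ.IsPrimitive) (h1 : χ ≠ 1) (h θ : ℝ) :
    diffXiCharErot χ (-h) θ = critReflect (diffXiCharErot χ h ((-θ - Complex.arg χ.rootNumber))) := by
  funext s
  rw [critReflect_apply, diffXiCharErot_apply, diffXiCharErot_apply, diffXiCharE_apply, diffXiCharE_apply]
  have e : (1 : ℂ) - conj s + h = 1 - conj (s - h) := by
    simp only [map_sub, Complex.conj_ofReal]; ring
  rw [e, dirichletXi_one_sub_conj hχ h1, map_mul, map_mul, Complex.conj_conj, ← mul_assoc,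
    conj_exp_negShiftAngle_mul hχ, Complex.ofReal_neg, ← sub_eq_add_neg]

/-- `A_{−h,θ}(·, χ) = A_{h,θ′}(·, χ)`, `θ′ = −θ − arg ε(χ)` (the `χ`-analogue of `A_{−h,θ} = A_{h,−θ}`).
[cite: Lagarias2005, §5 p.10 with §2 p.4 (A_{−h} = A_h)] -/
theorem diffXiCharArot_neg (hχ : χ.IsPrimitive) (h1 : χ ≠ 1) (h θ : ℝ) :
    diffXiCharArot χ (-h) θ = diffXiCharArot χ h ((-θ - Complex.arg χ.rootNumber)) := by
  show critRePart (diffXiCharErot χ (-h) θ) = critRePart (diffXiCharErot χ h ((-θ - Complex.arg χ.rootNumber)))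
  rw [diffXiCharErot_neg_eq_critReflect hχ h1, critRePart_critReflect]

/-- `B_{−h,θ}(·, χ) = −B_{h,θ′}(·, χ)`, `θ′ = −θ − arg ε(χ)` (the `χ`-analogue of `B_{−h,θ} = −B_{h,−θ}`).
[cite: Lagarias2005, §5 p.10 with §2 p.4 (B_{−h} = −B_h)] -/
theorem diffXiCharBrot_neg (hχ : χ.IsPrimitive) (h1 : χ ≠ 1) (h θ : ℝ) :
    diffXiCharBrot χ (-h) θ = -diffXiCharBrot χ h ((-θ - Complex.arg χ.rootNumber)) := by
  show critImPart (diffXiCharErot χ (-h) θ) = -critImPart (diffXiCharErot χ h ((-θ - Complex.arg χ.rootNumber)))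
  rw [diffXiCharErot_neg_eq_critReflect hχ h1, critImPart_critReflect]

/-- Negating a function preserves "all zeros on the critical line". [folklore] -/
private theorem allZerosOnCriticalLine_neg' {F : ℂ → ℂ} (hF : AllZerosOnCriticalLine F) :
    AllZerosOnCriticalLine (-F) := fun s hs ↦ hF s (by simpa using hs)

/-- Negating a function preserves "all zeros simple". [folklore] -/
private theorem allZerosSimple_neg' {F : ℂ → ℂ} (hF : AllZerosSimple F) : AllZerosSimple (-F) := by
  intro s hs
  rw [deriv.neg]
  exact neg_ne_zero.2 (hF s (by simpa using hs))

/-- Negating a function does not change its critical-line zero counts. [folklore] -/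
private theorem critZeroCountOn_neg' (F : ℂ → ℂ) (S : Set ℝ) : critZeroCountOn (-F) S = critZeroCountOn F S := by
  have h1 : critZeroOrdinates (-F) = critZeroOrdinates F := by
    ext t; simp [critZeroOrdinates]
  simp [critZeroCountOn, h1, analyticOrderNatAt, analyticOrderAt_neg]

/-- Negating the second function preserves interlacing. [folklore] -/
private theorem critZerosInterlace_neg_right' {F G : ℂ → ℂ} (hFG : CritZerosInterlace F G) :
    CritZerosInterlace F (-G) := by
  intro t₁ t₂ ht
  rw [critZeroCountOn_neg']
  exact hFG t₁ t₂ ht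

/-- **Lagarias 2005, Theorem 5.1 (1)** — discharge of `lagarias2005_thm_5_1_1` (RH-FREE): for a primitive
non-principal `χ`, `|h| ≥ ½` and `0 ≤ θ < 2π`, the zeros of `A_{h,θ}(s, χ)` and `B_{h,θ}(s, χ)` lie on
`Re(s) = ½`, are simple, and interlace. For `h ≥ ½`: `diffXiChar_zeroPattern`; for `h ≤ −½`:
`A_{h,θ} = A_{−h,θ′}`, `B_{h,θ} = −B_{−h,θ′}` (`diffXiCharArot_neg`, `diffXiCharBrot_neg`).
[cite: Lagarias2005, Theorem 5.1 (1) (arXiv p. 10; held text p0010 L85–104)] -/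
theorem lagarias2005_thm_5_1_1_holds : lagarias2005_thm_5_1_1 := by
  intro N _ χ hχ h1 h θ hh _ _
  rcases le_or_gt 0 h with h0 | h0
  · rw [abs_of_nonneg h0] at hh
    exact diffXiChar_zeroPattern hχ h1 hh θ
  · rw [abs_of_neg h0] at hh
    obtain ⟨hA, hB, hsA, hsB, hI⟩ := diffXiChar_zeroPattern hχ h1 hh ((-θ - Complex.arg χ.rootNumber))
    have eA : diffXiCharArot χ h θ = diffXiCharArot χ (-h) ((-θ - Complex.arg χ.rootNumber)) := by
      rw [← diffXiCharArot_neg hχ h1, neg_neg]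
    have eB : diffXiCharBrot χ h θ = -diffXiCharBrot χ (-h) ((-θ - Complex.arg χ.rootNumber)) := by
      rw [← diffXiCharBrot_neg hχ h1, neg_neg]
    rw [eA, eB]
    exact ⟨hA, allZerosOnCriticalLine_neg' hB, hsA, allZerosSimple_neg' hsB, critZerosInterlace_neg_right' hI⟩

end Dirichlet

end Literature.NumberTheory.LFunctions
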